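import Literature.NumberTheory.EllipticCurves.FormalGroupChart
import HarnessLib

/-!
# The level subgroups `E⁽ᵗ⁾ = {P ∈ E₁ : |z(P)| ≤ t}` of the kernel of reduction

Topic `NumberTheory/EllipticCurves`. For a Weierstrass equation `V` with `w`-integral
coefficients over a valued field `(F, w)` the kernel of reduction `E₁(F)`
(`FormalGroupChart.kernel w V`: `O` and the affine points with `|x| > 1`) carries the local
parameter `z = -x/y` (`WeierstrassCurve.Affine.Point.zCoord`), and the tree's quantitative chart
estimates (`FormalGroupChart.val_zCoord_add_le`, `val_zCoord_neg`, `val_zCoord_sub`; Silverman,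
*AEC*, IV.1 and Prop. VII.2.2) make every **level set** `{P ∈ E₁ : |z(P)| ≤ t}`, `t ∈ ℝ≥0`, a
subgroup — the filtration `Ê(𝓜) ⊇ Ê(𝓜²) ⊇ ⋯` of *AEC* IV.3.2 transported to points by
Prop. VII.2.2, for an arbitrary valued field and real thresholds `t` (the tree's
`WeierstrassCurve.formalFiltration` is the special case `F = ℚ_p`, `t = p⁻ⁿ`). This file
introduces that subgroup and its unfolding lemmas; nothing else.

* `FormalGroupChart.level w V t` — the `AddSubgroup` `{P ∈ E₁ : |z(P)| ≤ t}`;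
* `mem_level_iff`, `level_le_kernel`, `level_mono`, `level_eq_kernel_of_one_le`,
  `sub_mem_level_iff` (`P - Q ∈ E⁽ᵗ⁾ ↔ |z(P) - z(Q)| ≤ t` on `E₁`: `z` is an isometry).

## References

* [SilvermanAEC2009] J. H. Silverman, *The Arithmetic of Elliptic Curves*, 2nd ed., GTM 106
  (2009), IV.3.2 (the subgroups `Ê(𝓜ⁿ)`), Prop. VII.2.2 (`E₁(K) ≅ Ê(𝓜)` via `z = -x/y`).
-/

noncomputable section

open scoped Classical NNReal

namespace Literature.NumberTheory.EllipticCurves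

namespace FormalGroupChart

variable {F : Type*} [Field F] (w : Valuation F ℝ≥0) (V : WeierstrassCurve F)
  [hV : V.IsIntegral w.integer]

/-- **The level subgroup `E⁽ᵗ⁾ = {P ∈ E₁(F) : |z(P)| ≤ t}`** of the kernel of reduction of a
`w`-integral Weierstrass equation over a valued field `(F, w)`, for a threshold `t ∈ ℝ≥0`
(Silverman, *AEC*, IV.3.2: the subgroups `Ê(𝓜ⁿ)` of the formal group, read on points through
`z = -x/y`, Prop. VII.2.2). It is a subgroup because `|z(P + Q)| ≤ max(|z(P)|, |z(Q)|)` and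
`|z(-P)| = |z(P)|` on `E₁` (`val_zCoord_add_le`, `val_zCoord_neg`). For `t ≥ 1` it is all of
`E₁` (`level_eq_kernel_of_one_le`). [cite: SilvermanAEC2009, Prop. IV.3.2(a) with Prop. VII.2.2] -/
def level (t : ℝ≥0) : AddSubgroup V.toAffine.Point where
  carrier := {P | P ∈ kernel w V ∧ w P.zCoord ≤ t}
  zero_mem' := ⟨(kernel w V).zero_mem, by
    rw [WeierstrassCurve.Affine.Point.zCoord_zero, map_zero]; exact zero_le⟩
  add_mem' := fun {P Q} hP hQ ↦ ⟨(kernel w V).add_mem hP.1 hQ.1,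
    (val_zCoord_add_le hP.1 hQ.1).trans (max_le hP.2 hQ.2)⟩
  neg_mem' := fun {P} hP ↦ ⟨(kernel w V).neg_mem hP.1, by rw [val_zCoord_neg hP.1]; exact hP.2⟩

variable {w V}

/-- Membership in `E⁽ᵗ⁾`: `P ∈ E₁` and `|z(P)| ≤ t`. [folklore] -/
theorem mem_level_iff {t : ℝ≥0} {P : V.toAffine.Point} :
    P ∈ level w V t ↔ P ∈ kernel w V ∧ w P.zCoord ≤ t :=
  Iff.rfl

/-- `E⁽ᵗ⁾ ⊆ E₁`. [folklore] -/
theorem level_le_kernel (t : ℝ≥0) : level w V t ≤ kernel w V :=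
  fun _ hP ↦ hP.1

/-- The levels decrease with the threshold: `t ≤ t' ⇒ E⁽ᵗ⁾ ⊆ E⁽ᵗ'⁾`. [folklore] -/
theorem level_mono {t t' : ℝ≥0} (h : t ≤ t') : level w V t ≤ level w V t' :=
  fun _ hP ↦ ⟨hP.1, hP.2.trans h⟩

/-- For `t ≥ 1` the level `E⁽ᵗ⁾` is the whole kernel of reduction (`|z| < 1` on `E₁`,
`val_zCoord_lt_one`). [cite: SilvermanAEC2009, Prop. VII.2.2] -/
theorem level_eq_kernel_of_one_le {t : ℝ≥0} (ht : 1 ≤ t) : level w V t = kernel w V :=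
  le_antisymm (level_le_kernel t) fun _ hP ↦ ⟨hP, (val_zCoord_lt_one hP).le.trans ht⟩

/-- **`z` is an isometry on `E₁`**: for `P, Q ∈ E₁`, `P - Q ∈ E⁽ᵗ⁾ ↔ |z(P) - z(Q)| ≤ t`
(`val_zCoord_sub`). [cite: SilvermanAEC2009, Prop. VII.2.2] -/
theorem sub_mem_level_iff {t : ℝ≥0} {P Q : V.toAffine.Point} (hP : P ∈ kernel w V)
    (hQ : Q ∈ kernel w V) : P - Q ∈ level w V t ↔ w (P.zCoord - Q.zCoord) ≤ t := by
  rw [mem_level_iff, val_zCoord_sub hP hQ]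
  exact ⟨fun h ↦ h.2, fun h ↦ ⟨(kernel w V).sub_mem hP hQ, h⟩⟩

end FormalGroupChart

end Literature.NumberTheory.EllipticCurves

end
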